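import Summits.MatrixMultiplication.MatrixMultiplication.Theorems.FarEdgeDescentPencilRealisability
import HarnessLib

/-!
# FarEdgeDescent — FAR-TAIL FREEDOM (I): the lawful far tails are exactly the free class

Gen 24 (`FarEdgeDescentPencilRealisability`) showed that a full edge profile `x ↦ W(1,x,1)` on `[0,∞)` is the
pencil of a 3D-lawful functional iff it is admissible and satisfies the FOLD.  This file and its continuation
`FarEdgeDescentTailShadow` answer the finer question the critic (g26) and the census (B15 «lawful-world
automatism») left open: *which FAR TAILS* `g(x) = x + 1 + e(x)`, `x ≥ 1`, occur — with NO condition on the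
near side?

★ NECESSITY (`farExcess_free_of_laws`, `omega_farExcess_free`).  For every symmetric homogeneous subadditive
functional whose pencil dominates `x+1`, and for the true profile, the far excess `e` is convex, nonnegative
and obeys the CUBE-LINE COUPLING `e(1) − e(x) ≤ ((1 − e(1))/3)·(x − 1)` (`⟺ (x+2)·g(1) ≤ 3·g(x)`); for `ω`
it is moreover antitone (padding).

★ SUFFICIENCY (prepared here, assembled in `FarEdgeDescentTailShadow.foldShadow_realises` /
`farTail_realisable`).  Conversely EVERY `e : [1,∞) → ℝ` that is convex, antitone, nonnegative and cube-line
coupled is the far excess of a 3D-lawful functional (symmetric, homogeneous, subadditive, monotone, sandwiched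
`max(a+b,b+c,c+a) ≤ W ≤ a+b+c`): the FOLD SHADOW `F(t) = max(2, ((1+t)/2)·g(2/(1+t)))` (`t ≤ 1`), `F = g`
(`x ≥ 1`) is admissible with the fold, and its perspective world realises it.  This file proves the gluing
lemma, the secant form of the coupling (`secant_le`: every far secant of `e` has slope `≥ −(1 − e(1))/3`,
i.e. `ω ≤ 3σ + …` at the square) and the four properties of the near SHADOW TERM
`(3+t)/2 + ((1+t)/2)·e(2/(1+t))` on `[0,1]`: dominated by its `e(1)`-version, monotone, `1`-Lipschitz, convex
(it is the perspective of the convex far branch).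

So the hold «3D laws» constrains the far tail by NOTHING beyond {convex, antitone, `0 ≤ e`, cube line}: every
rate class on the special ladder (power, integrable, exponential, finitely saturated, …) is populated by
lawful worlds with `ω_W = 2 + e(1)` explicit.  Lens reading (structural dichotomy): on the GENERIC
(zero-free) class the laws are silent about the tail, so the SPECIAL leaf `FiniteSaturation` is load-bearing
at every rung, and any generic ⟹ special transfer needs an input that is not a consequence of {symmetry,
homogeneity, subadditivity, monotonicity, sandwich} on the edge pencil.
-/

set_option linter.dupNamespace false

noncomputable section

namespace Summit.MatrixMultiplication.MatrixMultiplication.Theorems.FarEdgeDescentTailFreedom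

open Literature.Computability.AlgebraicComplexity Set
open Summit.MatrixMultiplication.MatrixMultiplication.Theorems.FarEdgeDescentPencilRealisability

/-! ## §0 Gluing convexity across a point -/

/-- GLUING: convex on `[a,m]`, convex on `[m,∞)`, and the cross secant condition
`slope(x,m) ≤ slope(m,z)` (product form) for `x < m < z` ⟹ convex on `[a,∞)`. -/
theorem convexOn_Ici_of_glue {φ : ℝ → ℝ} {a m : ℝ} (ham : a ≤ m) (h0 : ConvexOn ℝ (Icc a m) φ)
    (h1 : ConvexOn ℝ (Ici m) φ)
    (hs : ∀ x z : ℝ, a ≤ x → x < m → m < z → (φ m - φ x) * (z - m) ≤ (φ z - φ m) * (m - x)) :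
    ConvexOn ℝ (Ici a) φ := by
  rw [convexOn_iff_slope_mono_adjacent]
  refine ⟨convex_Ici a, fun x y z hx hz hxy hyz => ?_⟩
  have hx' : a ≤ x := hx
  have hyx : 0 < y - x := by linarith
  have hzy : 0 < z - y := by linarith
  rcases le_or_gt z m with hzm | hmz
  · exact h0.slope_mono_adjacent ⟨hx', by linarith⟩ ⟨by linarith, hzm⟩ hxy hyz
  rcases le_or_gt m x with hmx | hxm
  · exact h1.slope_mono_adjacent (mem_Ici.2 hmx) (mem_Ici.2 (by linarith)) hxy hyz
  rcases lt_trichotomy y m with hym | rfl | hmy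
  · have A := h0.slope_mono_adjacent ⟨hx', le_of_lt hxm⟩ ⟨ham, le_rfl⟩ hxy hym
    have B := hs y z (by linarith) hym hmz
    have hmy' : 0 < m - y := by linarith
    refine A.trans ?_
    rw [div_le_div_iff₀ hmy' hzy]
    nlinarith [B]
  · rw [div_le_div_iff₀ hyx hzy]
    linarith [hs x z hx' hxm hmz]
  · have A := h1.slope_mono_adjacent (mem_Ici.2 le_rfl) (mem_Ici.2 (by linarith : m ≤ z)) hmy hyz
    have B := hs x y hx' hxm hmy
    have hym' : 0 < y - m := by linarith
    refine le_trans ?_ A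
    rw [div_le_div_iff₀ hyx hym']
    nlinarith [B]

/-! ## §1 NECESSITY: the far excess of a lawful functional lies in the free class -/

section Necessity

variable {W : ℝ → ℝ → ℝ → ℝ}
  (hsymm : ∀ a b c : ℝ, W a b c = W b a c ∧ W a b c = W a c b)
  (hhom : ∀ ν : ℝ, 0 < ν → ∀ a b c : ℝ, 0 < a → 0 < b → 0 < c →
    W (ν * a) (ν * b) (ν * c) = ν * W a b c)
  (hsub : ∀ a b c a' b' c' : ℝ, 0 < a → 0 < b → 0 < c → 0 < a' → 0 < b' → 0 < c' →
    W (a + a') (b + b') (c + c') ≤ W a b c + W a' b' c')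
include hhom hsub

/-- The pencil `x ↦ W(1,x,1)` of a homogeneous subadditive functional is convex on `(0,∞)`
(`W(a+b, ax+by, a+b) ≤ a·W(1,x,1) + b·W(1,y,1)`). -/
theorem pencil_convexOn_of_laws : ConvexOn ℝ (Ioi 0) (fun x : ℝ => W 1 x 1) := by
  refine ⟨convex_Ioi 0, fun x hx y hy a b ha hb hab => ?_⟩
  have hx : 0 < x := hx
  have hy : 0 < y := hy
  simp only [smul_eq_mul]
  rcases ha.eq_or_lt with rfl | ha'
  · simp only [zero_mul, zero_add] at hab ⊢
    rw [hab]; simp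
  rcases hb.eq_or_lt with rfl | hb'
  · simp only [zero_mul, add_zero] at hab ⊢
    rw [hab]; simp
  have h1 := hhom a ha' 1 x 1 one_pos hx one_pos
  have h2 := hhom b hb' 1 y 1 one_pos hy one_pos
  have h3 := hsub (a * 1) (a * x) (a * 1) (b * 1) (b * y) (b * 1) (by positivity) (by positivity)
    (by positivity) (by positivity) (by positivity) (by positivity)
  rw [h1, h2, show a * 1 + b * 1 = 1 by linarith] at h3
  exact h3

include hsymm in
/-- CUBE-LINE COUPLING in far-excess form: with `e(x) := W(1,x,1) − (x+1)`, the three laws force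
`e(1) − e(x) ≤ ((1 − e(1))/3)·(x − 1)` for `x ≥ 1` (`⟺ (x+2)·W(1,1,1) ≤ 3·W(1,x,1)`, `cubeLine_of_laws`). -/
theorem farExcess_cube_of_laws {x : ℝ} (hx : 1 ≤ x) :
    (W 1 1 1 - (1 + 1)) - (W 1 x 1 - (x + 1)) ≤ (1 - (W 1 1 1 - (1 + 1))) / 3 * (x - 1) := by
  have h := cubeLine_of_laws hsymm hhom hsub (show 0 < x by linarith)
  nlinarith [h]

include hsymm in
/-- NECESSITY (abstract): for a symmetric, homogeneous, subadditive functional whose pencil dominates `x+1`,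
the far excess is convex on `[1,∞)`, nonnegative, and cube-line coupled. -/
theorem farExcess_free_of_laws (hlow : ∀ x : ℝ, 0 < x → x + 1 ≤ W 1 x 1) :
    ConvexOn ℝ (Ici 1) (fun x : ℝ => W 1 x 1 - (x + 1)) ∧
    (∀ x : ℝ, 1 ≤ x → 0 ≤ W 1 x 1 - (x + 1)) ∧
    (∀ x : ℝ, 1 ≤ x → (W 1 1 1 - (1 + 1)) - (W 1 x 1 - (x + 1)) ≤
      (1 - (W 1 1 1 - (1 + 1))) / 3 * (x - 1)) := by
  refine ⟨?_, fun x hx => by linarith [hlow x (by linarith)],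
    fun x hx => farExcess_cube_of_laws hsymm hhom hsub hx⟩
  have hc := (pencil_convexOn_of_laws hhom hsub).subset
    (fun x (hx : 1 ≤ x) => show (0 : ℝ) < x by linarith) (convex_Ici 1)
  refine ⟨convex_Ici 1, fun x hx y hy a b ha hb hab => ?_⟩
  have h := hc.2 hx hy ha hb hab
  simp only [smul_eq_mul] at h ⊢
  nlinarith [h, hab]

end Necessity

/-- ★ NECESSITY for the true profile: the far excess `e(x) = ω(1,x,1) − (x+1)` on `[1,∞)` is convex
(Lotti–Romani), antitone (padding), nonnegative (information bound) and satisfies the cube-line coupling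
`e(1) − e(x) ≤ ((1 − e(1))/3)·(x − 1)`. -/
theorem omega_farExcess_free :
    ConvexOn ℝ (Ici 1) (fun x : ℝ => omegaRect ℂ 1 x 1 - (x + 1)) ∧
    AntitoneOn (fun x : ℝ => omegaRect ℂ 1 x 1 - (x + 1)) (Ici 1) ∧
    (∀ x : ℝ, 1 ≤ x → 0 ≤ omegaRect ℂ 1 x 1 - (x + 1)) ∧
    (∀ x : ℝ, 1 ≤ x → (omegaRect ℂ 1 1 1 - (1 + 1)) - (omegaRect ℂ 1 x 1 - (x + 1)) ≤
      (1 - (omegaRect ℂ 1 1 1 - (1 + 1))) / 3 * (x - 1)) := by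
  have R := farExcess_free_of_laws omegaRect_laws.1 omegaRect_laws.2.1 omegaRect_laws.2.2
    (fun x _ => add_one_le_omegaRect_one_mid_one ℂ x)
  refine ⟨R.1, fun x _ y _ hxy => ?_, R.2.1, R.2.2⟩
  have h := omegaRect_one_mid_one_le_add ℂ hxy
  show omegaRect ℂ 1 y 1 - (y + 1) ≤ omegaRect ℂ 1 x 1 - (x + 1)
  linarith

/-! ## §2 SUFFICIENCY: the fold shadow of a free tail is admissible with the fold -/

section FoldShadow

variable {e F : ℝ → ℝ}
  (hconv : ConvexOn ℝ (Ici 1) e) (hanti : AntitoneOn e (Ici 1)) (hnn : ∀ x : ℝ, 1 ≤ x → 0 ≤ e x)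
  (hcube : ∀ x : ℝ, 1 ≤ x → e 1 - e x ≤ (1 - e 1) / 3 * (x - 1))
  (hF : ∀ x : ℝ, F x = if 1 ≤ x then x + 1 + e x
    else max 2 ((3 + x) / 2 + (1 + x) / 2 * e (2 / (1 + x))))

include hanti hcube in
/-- `e(1) ≤ 1` (cube line at `x = 2` and antitonicity). -/
theorem e_one_le_one : e 1 ≤ 1 := by
  have h2 := hcube 2 (by norm_num)
  have h2' := hanti (mem_Ici.2 le_rfl) (mem_Ici.2 (by norm_num : (1:ℝ) ≤ 2)) (by norm_num : (1:ℝ) ≤ 2)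
  linarith

include hconv hcube in
/-- SECANT FORM of the coupling: every far secant of `e` has slope `≥ −(1 − e(1))/3`
(chord of the convex `e` through `1` and `v`, then the cube line at `v`). -/
theorem secant_le {u v : ℝ} (hu : 1 ≤ u) (huv : u ≤ v) : e u - e v ≤ (1 - e 1) / 3 * (v - u) := by
  rcases hu.eq_or_lt with h1 | hu1
  · rw [← h1]; exact hcube v (h1 ▸ huv)
  rcases huv.eq_or_lt with h2 | huv'
  · rw [h2]; simp
  have chord := hconv.secant_mono_aux1 (x := 1) (y := u) (z := v) (mem_Ici.2 le_rfl)
    (mem_Ici.2 (by linarith)) hu1 huv'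
  have hc := mul_le_mul_of_nonneg_left (hcube v (by linarith)) (sub_nonneg.2 huv'.le)
  have key : (v - 1) * (e u - e v) ≤ (v - 1) * ((1 - e 1) / 3 * (v - u)) := by nlinarith [chord, hc]
  exact le_of_mul_le_mul_left key (by linarith)

include hF in
/-- The far branch of the fold shadow: `F(x) = x + 1 + e(x)` for `x ≥ 1`. -/
theorem F_far {x : ℝ} (hx : 1 ≤ x) : F x = x + 1 + e x := by rw [hF, if_pos hx]

include hF hnn in
/-- The near branch of the fold shadow: `F(t) = max(2, (3+t)/2 + ((1+t)/2)·e(2/(1+t)))` for `t ≤ 1`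
(at `t = 1` both branches give `2 + e(1)`). -/
theorem F_near {x : ℝ} (hx1 : x ≤ 1) : F x = max 2 ((3 + x) / 2 + (1 + x) / 2 * e (2 / (1 + x))) := by
  rcases hx1.eq_or_lt with rfl | hlt
  · have h0 := hnn 1 le_rfl
    have h2 : (3 + 1 : ℝ) / 2 + (1 + 1) / 2 * e (2 / (1 + 1)) = 2 + e 1 := by norm_num
    rw [hF, if_pos le_rfl, h2, max_eq_right (by linarith)]
    ring
  · rw [hF, if_neg (not_le.2 hlt)]

/-- Near-side bookkeeping: for `0 ≤ x ≤ 1`, `w = 2/(1+x) ∈ [1,2]` and `(1+x)(w−1) = 1−x`. -/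
theorem near_arg {x : ℝ} (hx0 : 0 ≤ x) (hx1 : x ≤ 1) :
    1 ≤ 2 / (1 + x) ∧ 2 / (1 + x) ≤ 2 ∧ (1 + x) * (2 / (1 + x) - 1) = 1 - x := by
  have hp : 0 < 1 + x := by linarith
  refine ⟨by rw [le_div_iff₀ hp]; linarith, by rw [div_le_iff₀ hp]; linarith, ?_⟩
  field_simp
  ring

include hanti in
/-- The shadow term is dominated by its value with `e(1)` in place of `e(2/(1+x))`. -/
theorem shadow_le_e_one {x : ℝ} (hx0 : 0 ≤ x) (hx1 : x ≤ 1) :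
    (3 + x) / 2 + (1 + x) / 2 * e (2 / (1 + x)) ≤ (3 + x) / 2 + (1 + x) / 2 * e 1 := by
  obtain ⟨hw1, -, -⟩ := near_arg hx0 hx1
  have he := hanti (mem_Ici.2 le_rfl) (mem_Ici.2 hw1) hw1
  have : (1 + x) / 2 * e (2 / (1 + x)) ≤ (1 + x) / 2 * e 1 :=
    mul_le_mul_of_nonneg_left he (by linarith)
  linarith

include hanti hnn in
/-- The shadow term is monotone on `[0,1]`. -/
theorem shadow_mono {x y : ℝ} (hx0 : 0 ≤ x) (hxy : x ≤ y) (hy1 : y ≤ 1) :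
    (3 + x) / 2 + (1 + x) / 2 * e (2 / (1 + x)) ≤ (3 + y) / 2 + (1 + y) / 2 * e (2 / (1 + y)) := by
  obtain ⟨hwx, -, -⟩ := near_arg hx0 (hxy.trans hy1)
  obtain ⟨hwy, -, -⟩ := near_arg (hx0.trans hxy) hy1
  have hw : 2 / (1 + y) ≤ 2 / (1 + x) := div_le_div_of_nonneg_left (by norm_num) (by linarith) (by linarith)
  have he := hanti (mem_Ici.2 hwy) (mem_Ici.2 hwx) hw
  have h0 := hnn _ hwx
  have := mul_le_mul (show (1 + x) / 2 ≤ (1 + y) / 2 by linarith) he h0 (by linarith)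
  linarith

include hconv hanti hcube in
/-- The shadow term is `1`-Lipschitz on `[0,1]` (secant coupling and `e(1) ≤ 1`). -/
theorem shadow_lip {x y : ℝ} (hx0 : 0 ≤ x) (hxy : x ≤ y) (hy1 : y ≤ 1) :
    (3 + y) / 2 + (1 + y) / 2 * e (2 / (1 + y)) - ((3 + x) / 2 + (1 + x) / 2 * e (2 / (1 + x)))
      ≤ y - x := by
  obtain ⟨hwx, -, -⟩ := near_arg hx0 (hxy.trans hy1)
  obtain ⟨hwy, -, -⟩ := near_arg (hx0.trans hxy) hy1
  have hpx : 0 < 1 + x := by linarith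
  have hpy : 0 < 1 + y := by linarith
  have hw : 2 / (1 + y) ≤ 2 / (1 + x) := div_le_div_of_nonneg_left (by norm_num) hpx (by linarith)
  have sec := secant_le hconv hcube hwy hw
  have hvu : 2 / (1 + x) - 2 / (1 + y) = 2 * (y - x) / ((1 + x) * (1 + y)) := by
    field_simp
    ring
  have h1 : (1 + y) / 2 * (e (2 / (1 + y)) - e (2 / (1 + x))) ≤ (1 - e 1) / 3 * (y - x) := by
    have h := mul_le_mul_of_nonneg_left sec (show 0 ≤ (1 + y) / 2 by linarith)
    have hid : (1 + y) / 2 * ((1 - e 1) / 3 * (2 / (1 + x) - 2 / (1 + y))) =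
        (1 - e 1) / 3 * (y - x) / (1 + x) := by
      rw [hvu]
      field_simp
    rw [hid] at h
    have h1e := e_one_le_one hanti hcube
    have hle : (1 - e 1) / 3 * (y - x) / (1 + x) ≤ (1 - e 1) / 3 * (y - x) :=
      div_le_self (by nlinarith) (by linarith)
    exact h.trans hle
  have he1 := hanti (mem_Ici.2 le_rfl) (mem_Ici.2 hwx) hwx
  have h2 : (y - x) / 2 * e (2 / (1 + x)) ≤ (y - x) / 2 * e 1 :=
    mul_le_mul_of_nonneg_left he1 (by linarith)
  have h1e := e_one_le_one hanti hcube
  have hprod : 0 ≤ (y - x) * (1 - e 1) := mul_nonneg (by linarith) (by linarith)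
  nlinarith [h1, h2, hprod]

include hconv in
/-- The shadow term is convex on `[0,1]`: it is the perspective `((1+x)/2)·g(2/(1+x))` of the convex far
branch `g = x+1+e` (Jensen with the weights `a(1+x)/(1+z)`, `b(1+y)/(1+z)`). -/
theorem shadow_convex :
    ConvexOn ℝ (Icc 0 1) (fun x : ℝ => max 2 ((3 + x) / 2 + (1 + x) / 2 * e (2 / (1 + x)))) := by
  refine ⟨convex_Icc 0 1, fun x hx y hy a b ha hb hab => ?_⟩
  obtain ⟨hx0, hx1⟩ := hx
  obtain ⟨hy0, hy1⟩ := hy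
  simp only [smul_eq_mul]
  have hpx : 0 < 1 + x := by linarith
  have hpy : 0 < 1 + y := by linarith
  have hz0 : 0 ≤ a * x + b * y := by positivity
  have hpz : 0 < 1 + (a * x + b * y) := by linarith
  have hS : 1 + (a * x + b * y) = a * (1 + x) + b * (1 + y) := by linarith
  obtain ⟨hwx, -, -⟩ := near_arg hx0 hx1
  obtain ⟨hwy, -, -⟩ := near_arg hy0 hy1
  -- Jensen for `e` at the points 2/(1+x), 2/(1+y) with weights a(1+x)/(1+z), b(1+y)/(1+z)
  have hα : 0 ≤ a * (1 + x) / (1 + (a * x + b * y)) := by positivity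
  have hβ : 0 ≤ b * (1 + y) / (1 + (a * x + b * y)) := by positivity
  have hαβ : a * (1 + x) / (1 + (a * x + b * y)) + b * (1 + y) / (1 + (a * x + b * y)) = 1 := by
    rw [← add_div, ← hS, div_self hpz.ne']
  have J := hconv.2 (mem_Ici.2 hwx) (mem_Ici.2 hwy) hα hβ hαβ
  simp only [smul_eq_mul] at J
  have hpt : a * (1 + x) / (1 + (a * x + b * y)) * (2 / (1 + x)) +
      b * (1 + y) / (1 + (a * x + b * y)) * (2 / (1 + y)) = 2 / (1 + (a * x + b * y)) := by
    field_simp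
    linarith [hab]
  rw [hpt] at J
  have J' : (1 + (a * x + b * y)) / 2 * e (2 / (1 + (a * x + b * y))) ≤
      a * ((1 + x) / 2 * e (2 / (1 + x))) + b * ((1 + y) / 2 * e (2 / (1 + y))) := by
    have h := mul_le_mul_of_nonneg_left J (show 0 ≤ (1 + (a * x + b * y)) / 2 by linarith)
    have hid : (1 + (a * x + b * y)) / 2 * (a * (1 + x) / (1 + (a * x + b * y)) * e (2 / (1 + x)) +
        b * (1 + y) / (1 + (a * x + b * y)) * e (2 / (1 + y))) =
        a * ((1 + x) / 2 * e (2 / (1 + x))) + b * ((1 + y) / 2 * e (2 / (1 + y))) := by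
      field_simp
    rw [hid] at h
    exact h
  refine max_le ?_ ?_
  · have h1 : a * 2 ≤ a * max 2 ((3 + x) / 2 + (1 + x) / 2 * e (2 / (1 + x))) :=
      mul_le_mul_of_nonneg_left (le_max_left _ _) ha
    have h2 : b * 2 ≤ b * max 2 ((3 + y) / 2 + (1 + y) / 2 * e (2 / (1 + y))) :=
      mul_le_mul_of_nonneg_left (le_max_left _ _) hb
    linarith
  · have h1 : a * ((3 + x) / 2 + (1 + x) / 2 * e (2 / (1 + x))) ≤
        a * max 2 ((3 + x) / 2 + (1 + x) / 2 * e (2 / (1 + x))) :=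
      mul_le_mul_of_nonneg_left (le_max_right _ _) ha
    have h2 : b * ((3 + y) / 2 + (1 + y) / 2 * e (2 / (1 + y))) ≤
        b * max 2 ((3 + y) / 2 + (1 + y) / 2 * e (2 / (1 + y))) :=
      mul_le_mul_of_nonneg_left (le_max_right _ _) hb
    have h3 : (3 + (a * x + b * y)) / 2 = a * ((3 + x) / 2) + b * ((3 + y) / 2) := by linarith
    linarith [J']

end FoldShadow

end Summit.MatrixMultiplication.MatrixMultiplication.Theorems.FarEdgeDescentTailFreedom
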